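import Mathlib.Analysis.InnerProductSpace.PiL2
import Mathlib.Analysis.InnerProductSpace.Calculus
import Mathlib.MeasureTheory.Constructions.HaarToSphere
import Mathlib.MeasureTheory.Measure.Lebesgue.VolumeOfBalls
import Mathlib.MeasureTheory.Integral.IntervalIntegral.FundThmCalculus
import Mathlib.Analysis.SpecialFunctions.Integrals.Basic
import HarnessLib

/-!
# The Aubin–Talenti bubble `t/(t² + |x|²)` on `ℝ⁴`: mass and energy on balls

Aubin 1982, Thm. 2.14 (Aubin 1976 / Talenti 1976): the best constant `K(n,q)` in the Sobolev
inequality `‖φ‖_p ≤ K(n,q)‖∇φ‖_q` on `ℝⁿ` "is attained by the functions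
`φ(x) = (λ + ‖x‖^{q/(q−1)})^{1−n/q}`"; for `n = 4`, `q = 2` these are the multiples of the
*bubbles* `u_t(x) = t/(t² + |x|²)`, `t > 0` (`= t⁻¹(1 + |x/t|²)⁻¹`), and
`K(4,2)⁻² = ‖∇u_t‖₂²/‖u_t‖₄² = 8√6 π = n(n−1)ω_n^{2/n}|_{n=4} = Y(S⁴)` (Aubin 1982, Thm. 6.7).
This file PROVES the two explicit integrals behind that value, in the truncated form used by
local test functions (Aubin 1982, proof of Thm. 6.7 (α) / Lemma 2.24):

* `setIntegral_ball_fun_norm_euclideanSpace_four` — polar coordinates on balls of `ℝ⁴`,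
  `∫_{|x|<R} f(|x|) dx = 2π² ∫₀ᴿ r³ f(r) dr` (Mathlib's `integral_fun_norm_addHaar` and
  `vol(B₁) = π²/2`);
* `le_setIntegral_ball_bubble_pow_four` — `∫_{|x|<R} u_t⁴ dx ≥ π²/6 − π²t⁴/(2R⁴)`
  (`∫_{ℝ⁴} u_t⁴ = π²/6`; exact antiderivative `hasDerivAt_bubble_vol_antideriv`);
* `setIntegral_ball_bubble_grad_le` — `∫_{|x|<R} |du_t|² dx ≤ 4π²/3 = ∫_{ℝ⁴} |du_t|²`
  (`|du_t|² = 4t²|x|²/(t²+|x|²)⁴`, `norm_fderiv_bubble_sq`; antiderivative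
  `hasDerivAt_bubble_grad_antideriv`), whence `6 · (4π²/3) = 8π² = 8√6π · (π²/6)^{1/2}`;
* `contDiff_bubble`, `hasFDerivAt_bubble`, `norm_fderiv_bubble_sq` — calculus of `u_t`.

Everything is proved; no definitions (the bubble is the explicit expression
`fun x ↦ t / (t ^ 2 + ‖x‖ ^ 2)`), no named facts. Used by
`AubinTestFunctionFour.lean` (the cut-off test function) and, through it, by Aubin's inequality
`Y(M,[g]) ≤ Y(S⁴)` (`Geometry/Riemannian/AubinYamabeSphereProofs.lean`).

## References

* T. Aubin, *Nonlinear Analysis on Manifolds. Monge–Ampère Equations*, Grundlehren 252, Springer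
  1982, Ch. 2, §6, Thm. 2.14 (extremal functions, value of `K(n,q)`); Ch. 6, Thm. 6.7. [Aubin1982]
* T. Aubin, *Problèmes isopérimétriques et espaces de Sobolev*, J. Differential Geom. 11 (1976)
  573–598. [Aubin1976]
-/

noncomputable section

open MeasureTheory Set Metric Filter Real Module intervalIntegral
open scoped Topology ENNReal ContDiff

namespace Literature.Analysis.FunctionSpaces

/-! ### One-dimensional radial integrals -/

/-- `d/dr (t² + r²) = 2r`. [folklore] -/
theorem hasDerivAt_t_sq_add_sq (t r : ℝ) : HasDerivAt (fun r : ℝ => t ^ 2 + r ^ 2) (2 * r) r := by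
  refine ((hasDerivAt_pow 2 r).const_add (t ^ 2)).congr_deriv ?_
  push_cast
  ring

/-- **Antiderivative of the radial `L⁴`-mass density of the bubble**:
`d/dr [(−t⁶ − 3t⁴r²)/(12(t²+r²)³)] = r³ (t/(t²+r²))⁴` (`t > 0`). Aubin 1982, Ch. 2, §6 (the
integrals `∫ yᵖ r^{n−1} dr` behind `K(n,q)`), here `n = 4`, `q = 2`. [cite: Aubin1982, Ch. 2, §6, Thm. 2.14] -/
theorem hasDerivAt_bubble_vol_antideriv {t : ℝ} (ht : 0 < t) (r : ℝ) :
    HasDerivAt (fun r : ℝ => (-t ^ 6 - 3 * t ^ 4 * r ^ 2) / (12 * (t ^ 2 + r ^ 2) ^ 3))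
      (r ^ 3 * (t / (t ^ 2 + r ^ 2)) ^ 4) r := by
  have hs : 0 < t ^ 2 + r ^ 2 := by positivity
  have hN : HasDerivAt (fun r : ℝ => -t ^ 6 - 3 * t ^ 4 * r ^ 2) (-(3 * t ^ 4 * (2 * r))) r := by
    refine (((hasDerivAt_pow 2 r).const_mul (3 * t ^ 4)).const_sub (-t ^ 6)).congr_deriv ?_
    push_cast
    ring
  have hD : HasDerivAt (fun r : ℝ => 12 * (t ^ 2 + r ^ 2) ^ 3)
      (12 * (3 * (t ^ 2 + r ^ 2) ^ 2 * (2 * r))) r := by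
    refine (((hasDerivAt_t_sq_add_sq t r).pow 3).const_mul 12).congr_deriv ?_
    push_cast
    ring
  refine (hN.fun_div hD (by positivity)).congr_deriv ?_
  field_simp
  ring

/-- **Antiderivative of the radial energy density of the bubble**:
`d/dr [(−t⁴ − 3t²r² − 3r⁴)/(6(t²+r²)³)] = r⁵/(t²+r²)⁴` (`t > 0`). Aubin 1982, Ch. 2, §6
(the integrals `∫ |y'|^q r^{n−1} dr` behind `K(n,q)`), `n = 4`, `q = 2`. [cite: Aubin1982, Ch. 2, §6, Thm. 2.14] -/
theorem hasDerivAt_bubble_grad_antideriv {t : ℝ} (ht : 0 < t) (r : ℝ) :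
    HasDerivAt (fun r : ℝ => (-t ^ 4 - 3 * t ^ 2 * r ^ 2 - 3 * r ^ 4) / (6 * (t ^ 2 + r ^ 2) ^ 3))
      (r ^ 5 / (t ^ 2 + r ^ 2) ^ 4) r := by
  have hs : 0 < t ^ 2 + r ^ 2 := by positivity
  have hN : HasDerivAt (fun r : ℝ => -t ^ 4 - 3 * t ^ 2 * r ^ 2 - 3 * r ^ 4)
      (-(3 * t ^ 2 * (2 * r)) - 3 * (4 * r ^ 3)) r := by
    refine ((((hasDerivAt_pow 2 r).const_mul (3 * t ^ 2)).const_sub (-t ^ 4)).sub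
      ((hasDerivAt_pow 4 r).const_mul 3)).congr_deriv ?_
    push_cast
    ring
  have hD : HasDerivAt (fun r : ℝ => 6 * (t ^ 2 + r ^ 2) ^ 3)
      (6 * (3 * (t ^ 2 + r ^ 2) ^ 2 * (2 * r))) r := by
    refine (((hasDerivAt_t_sq_add_sq t r).pow 3).const_mul 6).congr_deriv ?_
    push_cast
    ring
  refine (hN.fun_div hD (by positivity)).congr_deriv ?_
  field_simp
  ring

/-- **Truncated radial `L⁴`-mass of the bubble**: `∫₀ᴿ r³ (t/(t²+r²))⁴ dr ≥ 1/12 − t⁴/(4R⁴)`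
(the full integral over `(0,∞)` is `1/12`). [cite: Aubin1982, Ch. 2, §6, Thm. 2.14] -/
theorem le_integral_pow_three_mul_bubble_pow_four {t R : ℝ} (ht : 0 < t) (hR : 0 < R) :
    1 / 12 - t ^ 4 / (4 * R ^ 4) ≤ ∫ r in 0..R, r ^ 3 * (t / (t ^ 2 + r ^ 2)) ^ 4 := by
  have hcont : Continuous fun r : ℝ => r ^ 3 * (t / (t ^ 2 + r ^ 2)) ^ 4 := by
    refine (continuous_pow 3).mul ((continuous_const.div ?_ fun r => ?_).pow 4)
    · exact continuous_const.add (continuous_pow 2)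
    · positivity
  rw [integral_eq_sub_of_hasDerivAt (fun r _ => hasDerivAt_bubble_vol_antideriv ht r)
    (hcont.intervalIntegrable _ _)]
  have hR4 : 0 < R ^ 4 := by positivity
  have hs : 0 < t ^ 2 + R ^ 2 := by positivity
  have key : -(t ^ 4 / (4 * R ^ 4)) ≤ (-t ^ 6 - 3 * t ^ 4 * R ^ 2) / (12 * (t ^ 2 + R ^ 2) ^ 3) := by
    rw [neg_le, ← neg_div, div_le_div_iff₀ (by positivity) (by positivity)]
    nlinarith [pow_pos ht 4, pow_pos ht 6, pow_pos hR 2, mul_pos (pow_pos ht 4) (pow_pos hR 4),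
      mul_pos (pow_pos ht 6) (pow_pos hR 4), mul_pos (pow_pos ht 8) (pow_pos hR 2), pow_pos ht 10,
      mul_pos (mul_pos (pow_pos ht 4) (pow_pos hR 4)) (pow_pos hR 2)]
  have h0 : (-t ^ 6 - 3 * t ^ 4 * (0:ℝ) ^ 2) / (12 * (t ^ 2 + (0:ℝ) ^ 2) ^ 3) = -(1 / 12) := by
    field_simp
    ring
  rw [h0]
  linarith

/-- **Truncated radial energy of the bubble**: `∫₀ᴿ r³ · 4t²r²/(t²+r²)⁴ dr ≤ 2/3` (the full
integral over `(0,∞)` is `2/3`, independently of `t`). [cite: Aubin1982, Ch. 2, §6, Thm. 2.14] -/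
theorem integral_pow_three_mul_bubble_grad_le {t R : ℝ} (ht : 0 < t) :
    ∫ r in 0..R, r ^ 3 * (4 * t ^ 2 * r ^ 2 / (t ^ 2 + r ^ 2) ^ 4) ≤ 2 / 3 := by
  have hcont : Continuous fun r : ℝ => r ^ 5 / (t ^ 2 + r ^ 2) ^ 4 := by
    refine (continuous_pow 5).div ((continuous_const.add (continuous_pow 2)).pow 4) fun r => ?_
    positivity
  have h1 : ∫ r in 0..R, r ^ 3 * (4 * t ^ 2 * r ^ 2 / (t ^ 2 + r ^ 2) ^ 4) =
      4 * t ^ 2 * ∫ r in 0..R, r ^ 5 / (t ^ 2 + r ^ 2) ^ 4 := by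
    rw [← intervalIntegral.integral_const_mul]
    refine integral_congr fun r _ => ?_
    ring
  rw [h1, integral_eq_sub_of_hasDerivAt (fun r _ => hasDerivAt_bubble_grad_antideriv ht r)
    (hcont.intervalIntegrable _ _)]
  have hs : 0 < t ^ 2 + R ^ 2 := by positivity
  have hR' : (-t ^ 4 - 3 * t ^ 2 * R ^ 2 - 3 * R ^ 4) / (6 * (t ^ 2 + R ^ 2) ^ 3) ≤ 0 :=
    div_nonpos_of_nonpos_of_nonneg (by nlinarith [pow_pos ht 4, sq_nonneg R, pow_pos ht 2])
      (by positivity)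
  have h0 : (-t ^ 4 - 3 * t ^ 2 * (0:ℝ) ^ 2 - 3 * (0:ℝ) ^ 4) / (6 * (t ^ 2 + (0:ℝ) ^ 2) ^ 3) =
      -(1 / (6 * t ^ 2)) := by
    field_simp
    ring
  rw [h0]
  have ht2 : 0 < t ^ 2 := by positivity
  calc 4 * t ^ 2 * ((-t ^ 4 - 3 * t ^ 2 * R ^ 2 - 3 * R ^ 4) / (6 * (t ^ 2 + R ^ 2) ^ 3) -
      -(1 / (6 * t ^ 2))) ≤ 4 * t ^ 2 * (0 - -(1 / (6 * t ^ 2))) := by gcongr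
    _ = 2 / 3 := by field_simp; ring



/-! ### Polar coordinates on balls of `ℝ⁴` -/

/-- The unit ball of `ℝ⁴` has volume `π²/2` (Mathlib's `volume_ball_of_dim_even`). [folklore] -/
theorem volume_real_ball_zero_one_euclideanSpace_four :
    (volume : Measure (EuclideanSpace ℝ (Fin 4))).real (ball 0 1) = π ^ 2 / 2 := by
  rw [measureReal_def, InnerProductSpace.volume_ball_of_dim_even (k := 2)
    (by rw [finrank_euclideanSpace_fin]) (0 : EuclideanSpace ℝ (Fin 4)) 1]
  rw [ENNReal.toReal_mul, ENNReal.ofReal_one, one_pow, ENNReal.toReal_one, one_mul,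
    ENNReal.toReal_ofReal (by positivity)]
  norm_num

/-- **Polar coordinates on balls of `ℝ⁴`**: for every `f : ℝ → ℝ` and `R ≥ 0`,
`∫_{|x|<R} f(|x|) dx = 2π² ∫₀ᴿ r³ f(r) dr` (`2π² = |S³| = 4 · vol B₁`; Mathlib's
`integral_fun_norm_addHaar` applied to `1_{[0,R)} f`; no integrability hypothesis, both sides
being `0` together in the non-integrable case). Aubin 1982, Ch. 2, §6 (reduction to radial
integrals `ω_{n−1} ∫ … r^{n−1} dr`). [folklore] -/
theorem setIntegral_ball_fun_norm_euclideanSpace_four (f : ℝ → ℝ) {R : ℝ} (hR : 0 ≤ R) :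
    ∫ x in ball (0 : EuclideanSpace ℝ (Fin 4)) R, f ‖x‖ =
      2 * π ^ 2 * ∫ r in 0..R, r ^ 3 * f r := by
  have h1 : ∫ x in ball (0 : EuclideanSpace ℝ (Fin 4)) R, f ‖x‖ =
      ∫ x : EuclideanSpace ℝ (Fin 4), (Iio R).indicator f ‖x‖ := by
    rw [← MeasureTheory.integral_indicator measurableSet_ball]
    refine integral_congr_ae (Eventually.of_forall fun x => ?_)
    show _ = (Iio R).indicator f ‖x‖
    by_cases hx : ‖x‖ < R
    · rw [indicator_of_mem (mem_ball_zero_iff.2 hx), indicator_of_mem (mem_Iio.2 hx)]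
    · rw [indicator_of_notMem (fun h => hx (mem_ball_zero_iff.1 h)),
        indicator_of_notMem (fun h => hx (mem_Iio.1 h))]
  rw [h1, integral_fun_norm_addHaar volume ((Iio R).indicator f), finrank_euclideanSpace_fin,
    volume_real_ball_zero_one_euclideanSpace_four]
  simp only [Nat.add_one_sub_one, smul_eq_mul, nsmul_eq_mul, Nat.cast_ofNat]
  have h2 : ∫ y in Ioi (0:ℝ), y ^ 3 * (Iio R).indicator f y =
      ∫ y in Ioi (0:ℝ), (Iio R).indicator (fun y => y ^ 3 * f y) y := by
    refine setIntegral_congr_fun measurableSet_Ioi fun y _ => ?_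
    by_cases hy : y ∈ Iio R
    · rw [indicator_of_mem hy, indicator_of_mem hy]
    · rw [indicator_of_notMem hy, indicator_of_notMem hy, mul_zero]
  rw [h2, setIntegral_indicator measurableSet_Iio, Ioi_inter_Iio, ← integral_Ioc_eq_integral_Ioo,
    ← intervalIntegral.integral_of_le hR]
  ring

/-! ### The bubble on `ℝ⁴`: mass and energy on balls, calculus -/

/-- **`L⁴`-mass of the bubble on a ball**: `∫_{|x|<R} (t/(t²+|x|²))⁴ dx ≥ π²/6 − π²t⁴/(2R⁴)`
for `t, R > 0` (the mass over all of `ℝ⁴` is `π²/6`; the truncation error vanishes as `t → 0`).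
Aubin 1982, Thm. 2.14 (`n = 4`, `q = 2`, `‖φ‖_p` of the extremal function). [cite: Aubin1982, Ch. 2, §6, Thm. 2.14] -/
theorem le_setIntegral_ball_bubble_pow_four {t R : ℝ} (ht : 0 < t) (hR : 0 < R) :
    π ^ 2 / 6 - π ^ 2 * t ^ 4 / (2 * R ^ 4) ≤
      ∫ x in ball (0 : EuclideanSpace ℝ (Fin 4)) R, (t / (t ^ 2 + ‖x‖ ^ 2)) ^ 4 := by
  rw [setIntegral_ball_fun_norm_euclideanSpace_four (fun r => (t / (t ^ 2 + r ^ 2)) ^ 4) hR.le]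
  have h := le_integral_pow_three_mul_bubble_pow_four ht hR
  have h2 : π ^ 2 / 6 - π ^ 2 * t ^ 4 / (2 * R ^ 4) = 2 * π ^ 2 * (1 / 12 - t ^ 4 / (4 * R ^ 4)) := by
    field_simp
    ring
  rw [h2]
  exact mul_le_mul_of_nonneg_left h (by positivity)

/-- **Energy of the bubble on a ball**: `∫_{|x|<R} 4t²|x|²/(t²+|x|²)⁴ dx ≤ 4π²/3` for `t > 0`,
`R ≥ 0` (the integrand is `|du_t|²`, `norm_fderiv_bubble_sq`; the energy over all of `ℝ⁴` is
`4π²/3`, so that `6 · 4π²/3 = 8π² = 8√6π (π²/6)^{1/2}`: the bubble realises `Y(S⁴) = 8√6π`).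
Aubin 1982, Thm. 2.14 (`‖∇φ‖_q` of the extremal function). [cite: Aubin1982, Ch. 2, §6, Thm. 2.14] -/
theorem setIntegral_ball_bubble_grad_le {t R : ℝ} (ht : 0 < t) (hR : 0 ≤ R) :
    ∫ x in ball (0 : EuclideanSpace ℝ (Fin 4)) R, 4 * t ^ 2 * ‖x‖ ^ 2 / (t ^ 2 + ‖x‖ ^ 2) ^ 4 ≤
      4 * π ^ 2 / 3 := by
  rw [setIntegral_ball_fun_norm_euclideanSpace_four
    (fun r => 4 * t ^ 2 * r ^ 2 / (t ^ 2 + r ^ 2) ^ 4) hR]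
  have h := integral_pow_three_mul_bubble_grad_le (R := R) ht
  calc 2 * π ^ 2 * ∫ r in 0..R, r ^ 3 * (4 * t ^ 2 * r ^ 2 / (t ^ 2 + r ^ 2) ^ 4)
      ≤ 2 * π ^ 2 * (2 / 3) := mul_le_mul_of_nonneg_left h (by positivity)
    _ = 4 * π ^ 2 / 3 := by ring

/-- The bubble `x ↦ t/(t² + |x|²)` is `C^∞` on `ℝ⁴` for `t > 0`. [folklore] -/
theorem contDiff_bubble {t : ℝ} (ht : 0 < t) {n : WithTop ℕ∞} :
    ContDiff ℝ n fun x : EuclideanSpace ℝ (Fin 4) => t / (t ^ 2 + ‖x‖ ^ 2) := by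
  refine contDiff_const.div (contDiff_const.add (contDiff_norm_sq ℝ)) fun x => ?_
  positivity

/-- **Differential of the bubble**: `d(t/(t²+|x|²))_x = −(2t/(t²+|x|²)²) ⟨x, ·⟩`. [folklore] -/
theorem hasFDerivAt_bubble {t : ℝ} (ht : 0 < t) (x : EuclideanSpace ℝ (Fin 4)) :
    HasFDerivAt (fun x : EuclideanSpace ℝ (Fin 4) => t / (t ^ 2 + ‖x‖ ^ 2))
      ((-(2 * t / (t ^ 2 + ‖x‖ ^ 2) ^ 2)) • innerSL ℝ x) x := by
  have hs : t ^ 2 + ‖x‖ ^ 2 ≠ 0 := by positivity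
  have h1 : HasFDerivAt (fun x : EuclideanSpace ℝ (Fin 4) => t ^ 2 + ‖x‖ ^ 2)
      ((2:ℝ) • innerSL ℝ x) x := by
    refine (((hasStrictFDerivAt_norm_sq x).hasFDerivAt).const_add (t ^ 2)).congr_fderiv ?_
    rw [← Nat.cast_smul_eq_nsmul ℝ, Nat.cast_ofNat]
  have h2 := ((hasDerivAt_inv hs).comp_hasFDerivAt x h1).const_mul t
  have h3 : (fun x : EuclideanSpace ℝ (Fin 4) => t / (t ^ 2 + ‖x‖ ^ 2)) =
      fun x => t * ((fun y : ℝ => y⁻¹) ∘ fun x : EuclideanSpace ℝ (Fin 4) => t ^ 2 + ‖x‖ ^ 2) x := by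
    funext y
    simp [div_eq_mul_inv]
  rw [h3]
  refine h2.congr_fderiv ?_
  rw [smul_smul, smul_smul]
  congr 1
  field_simp

/-- **Energy density of the bubble**: `|d(t/(t²+|x|²))_x|² = 4t²|x|²/(t²+|x|²)⁴` (operator
norm of the differential; `‖⟨x, ·⟩‖ = |x|`). [folklore] -/
theorem norm_fderiv_bubble_sq {t : ℝ} (ht : 0 < t) (x : EuclideanSpace ℝ (Fin 4)) :
    ‖fderiv ℝ (fun x : EuclideanSpace ℝ (Fin 4) => t / (t ^ 2 + ‖x‖ ^ 2)) x‖ ^ 2 =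
      4 * t ^ 2 * ‖x‖ ^ 2 / (t ^ 2 + ‖x‖ ^ 2) ^ 4 := by
  rw [(hasFDerivAt_bubble ht x).fderiv, norm_smul, innerSL_apply_norm, Real.norm_eq_abs, mul_pow,
    sq_abs]
  have hs : t ^ 2 + ‖x‖ ^ 2 ≠ 0 := by positivity
  field_simp
  ring


variable {E : Type*} [NormedAddCommGroup E] [NormedSpace ℝ E]

end Literature.Analysis.FunctionSpaces

end
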